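import Mathlib
import Literature.Analysis.FluidPDE.ElgindiWeightedIBP
import Summits.NavierStokesRegularity.NavierStokesRegularity.Theorems.EulerZoomLiouvillePowerGaugeEulerLiouvilleBeltramiPastMember
import Summits.NavierStokesRegularity.NavierStokesRegularity.Theorems.EulerZoomLiouvillePowerGaugeEulerLiouvilleFrozenLambMember
import HarnessLib

/-!
# Crux `EulerZoomLiouville.PowerGaugeEulerLiouville` (stmt-NavierStokesRegularity-19832), stub `stub_nonSelfSimilarRest`:
# FROZEN LAMB VECTOR, POINTWISE FORM — members whose Lamb vector `ω × u = (H − Hᵀ)u` is a.e. a TIME-INDEPENDENT field (mod gradients) on a past slab are trivial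

Helper file (theorems only; `--supports stmt-NavierStokesRegularity-19832`; def-free).  Hand leafhand-ns-eulerzoomliouville-10 g4; the pointwise companion of
`…FrozenLambMember` (velocity-tested frozen advection ⇒ `∂ₜ²u = 0` in `𝒟'` ⇒ trivial), in the language of the weak gradient `H`, generalising hand g3's
`Birth.nonSelfSimilar_of_aeBeltramiPast` / `…_of_aeLambGradientPast` (the case `F = 0` below).

* `LambSlice.integral_inner_fderiv_apply_self_eq_neg_lambPairing` — THE SLICE IDENTITY `∫⟪V, Dη[V]⟫ = −∫ (⟪G V, η⟫ − ⟪G η, V⟫)` for `V` with whole-space weak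
  gradient `G`, `V, G ∈ L²_loc`, `tr G = 0` a.e., `η` a curl pair (weak Lamb identity `LambIdentity.integral_inner_fderiv_apply_self_eq` + `∫⟪V, Gη⟫ = −½∫(div η)|V|² = 0`;
  hand g3's computation inside `Loc.ae_eq_zero_of_aeLambGradientPast`, extracted).
* `Loc.ae_eq_zero_of_aeFrozenLambPairingPast` — MEMBER LEVEL, every `ρ > 0`: crux hypotheses verbatim, `T₁ ≤ 0`, and a TIME-INDEPENDENT table
  `F g a b` with `∫ (⟪H u, η⟫ − ⟪H η, u⟫)(t) dx = F g a b` for a.e. `t < T₁` and every curl pair `η = (∂ₐg)b − (∂_b g)a` (the Lamb vector pairs with curl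
  pairs independently of time: `ω × u ≡ L(x)` modulo gradients) ⇒ `u = 0` a.e. (slicing/Fubini and `∫ θ' = 0` give the velocity-tested frozen advection of
  `Loc.ae_eq_zero_of_frozenLambCurlPast`).
* `Loc.ae_eq_zero_of_aeFrozenLambVectorPast` — the physical special case: `⟪H(t,x)u(t,x), w⟫ − ⟪H(t,x)w, u(t,x)⟫ = ⟪L(x), w⟫` for a.e. `(t,x) ∈ (−∞,T₁) × ℝ³`, all
  `w`, for some `L : ℝ³ → ℝ³` (no regularity, measurability or decay of `L` assumed): `ω × u = L(x)` ⇒ trivial.  `L = 0` is `…_of_aeBeltramiPast`.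
* Binder language `Birth.nonSelfSimilar_of_aeFrozenLambPairingPast` / `Birth.nonSelfSimilar_of_aeFrozenLambVectorPast`.

WHAT THIS IS NOT: not a proof of the stub or of the crux (the generic member has a genuinely time-dependent Lamb vector); nothing about Navier–Stokes.
[folklore; MajdaBertozziCUP2002 §2.4]
-/

noncomputable section

-- flat `Theorems/<Route><Decl>…` files of one crux share the namespace of the crux (tree convention)
set_option linter.dupNamespace false

open MeasureTheory Set Filter Topology Metric Function TopologicalSpace
open scoped RealInnerProductSpace NNReal ENNReal ContDiff

namespace Summit.NavierStokesRegularity.NavierStokesRegularity.Theorems.PowerGaugeEulerLiouville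

open Literature.Analysis Literature.Analysis.FunctionSpaces Literature.Analysis.FluidPDE

namespace LambSlice

variable {V : EuclideanSpace ℝ (Fin 3) → EuclideanSpace ℝ (Fin 3)} {G : EuclideanSpace ℝ (Fin 3) → EuclideanSpace ℝ (Fin 3) →L[ℝ] EuclideanSpace ℝ (Fin 3)}

/-- **THE SLICE IDENTITY `∫⟪V, Dη[V]⟫ = −∫ (⟪G V, η⟫ − ⟪G η, V⟫)`** for `V` with whole-space weak gradient `G`, `V, G ∈ L²_loc`, `tr G = 0` a.e., and a curl pair
`η = (∂ₐg)b − (∂_b g)a` (divergence-free): the velocity-tested advection of a slice IS minus the pairing of its Lamb vector `(G − Gᵀ)V = ω × V` with `η`.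
[folklore; MajdaBertozziCUP2002 §2.4] -/
theorem integral_inner_fderiv_apply_self_eq_neg_lambPairing (hG : HasWeakFDerivOn (⊤ : Opens (EuclideanSpace ℝ (Fin 3))) volume V G)
    (hV2 : LocallyIntegrable (fun x => ‖V x‖ ^ 2) volume)
    (hG2 : LocallyIntegrable (fun x => ‖G x‖ ^ 2) volume)
    (htr : ∀ᵐ x ∂(volume : Measure (EuclideanSpace ℝ (Fin 3))),
      ∑ j, ⟪(EuclideanSpace.basisFun (Fin 3) ℝ) j, G x ((EuclideanSpace.basisFun (Fin 3) ℝ) j)⟫ = 0)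
    {g : EuclideanSpace ℝ (Fin 3) → ℝ} (hg : IsTestFunctionOn (⊤ : Opens (EuclideanSpace ℝ (Fin 3))) g) (a c' : EuclideanSpace ℝ (Fin 3)) :
    ∫ x, ⟪V x, fderiv ℝ (fun x => fderiv ℝ g x a • c' - fderiv ℝ g x c' • a) x (V x)⟫ =
      -∫ x, (⟪G x (V x), fderiv ℝ g x a • c' - fderiv ℝ g x c' • a⟫ - ⟪G x (fderiv ℝ g x a • c' - fderiv ℝ g x c' • a), V x⟫) := by
  -- adapted from Theorems/EulerZoomLiouvillePowerGaugeEulerLiouvilleBeltramiPastMember.lean (`Loc.ae_eq_zero_of_aeLambGradientPast`, hand g3)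
  have hη := isTestFunctionOn_curlPair hg a c'
  have hdivη := isDivFree_curlPair_of_contDiff (hg.contDiff.of_le (by norm_cast)) a c'
  rw [LambIdentity.integral_inner_fderiv_apply_self_eq hG hV2 hG2 hη]
  set b : OrthonormalBasis (Fin 3) ℝ (EuclideanSpace ℝ (Fin 3)) := EuclideanSpace.basisFun (Fin 3) ℝ with hb
  set η : EuclideanSpace ℝ (Fin 3) → EuclideanSpace ℝ (Fin 3) := fun x => fderiv ℝ g x a • c' - fderiv ℝ g x c' • a with hηdef
  obtain ⟨R, hR⟩ := (hη.hasCompactSupport.isCompact).isBounded.subset_closedBall (0 : EuclideanSpace ℝ (Fin 3))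
  set Ω : Set (EuclideanSpace ℝ (Fin 3)) := ball 0 (R + 1) with hΩ
  have hηΩ : tsupport η ⊆ Ω := hR.trans (closedBall_subset_ball (by linarith))
  have hGΩ : HasWeakFDerivOn (⟨Ω, isOpen_ball⟩ : Opens (EuclideanSpace ℝ (Fin 3))) volume V G :=
    HasWeakFDerivOn.mono_set_holds hG le_top
  have hKc : IsCompact (closedBall (0 : EuclideanSpace ℝ (Fin 3)) (R + 1)) := isCompact_closedBall _ _
  have hsub : Ω ⊆ closedBall 0 (R + 1) := ball_subset_closedBall
  have hVm : AEStronglyMeasurable V (volume.restrict Ω) := hGΩ.locallyIntegrableOn.aestronglyMeasurable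
  have hGm : AEStronglyMeasurable G (volume.restrict Ω) := hGΩ.locallyIntegrableOn_deriv.aestronglyMeasurable
  have hVL2 : MemLp V 2 (volume.restrict Ω) :=
    (memLp_two_iff_integrable_sq_norm hVm).2 ((hV2.integrableOn_isCompact hKc).mono_set hsub)
  have hGL2 : MemLp G 2 (volume.restrict Ω) :=
    (memLp_two_iff_integrable_sq_norm hGm).2 ((hG2.integrableOn_isCompact hKc).mono_set hsub)
  have hcomp : ∀ v : EuclideanSpace ℝ (Fin 3), MemLp (fun x => ⟪V x, v⟫) 2 (volume.restrict Ω) := by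
    intro v
    refine MemLp.of_le_mul hVL2 (hVm.inner aestronglyMeasurable_const) (c := ‖v‖) (Eventually.of_forall fun x => ?_)
    rw [mul_comm]; exact norm_inner_le_norm _ _
  have hGcomp : ∀ v w : EuclideanSpace ℝ (Fin 3), MemLp (fun x => ⟪v, G x w⟫) 2 (volume.restrict Ω) := by
    intro v w
    have h1 : AEStronglyMeasurable (fun x => G x w) (volume.restrict Ω) :=
      (ContinuousLinearMap.apply ℝ (EuclideanSpace ℝ (Fin 3)) w).continuous.comp_aestronglyMeasurable hGm
    refine MemLp.of_le_mul hGL2 (aestronglyMeasurable_const.inner h1) (c := ‖v‖ * ‖w‖) (Eventually.of_forall fun x => ?_)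
    calc ‖⟪v, G x w⟫‖ ≤ ‖v‖ * ‖G x w‖ := norm_inner_le_norm _ _
      _ ≤ ‖v‖ * (‖G x‖ * ‖w‖) := mul_le_mul_of_nonneg_left (ContinuousLinearMap.le_opNorm _ _) (norm_nonneg _)
      _ = ‖v‖ * ‖w‖ * ‖G x‖ := by ring
  have hφ : ∀ i, IsTestFunctionOn (⊤ : Opens (EuclideanSpace ℝ (Fin 3))) (fun x => ⟪b i, η x⟫) := fun i =>
    ⟨contDiff_const.inner ℝ hη.contDiff, hη.hasCompactSupport.mono (fun x hx => by intro h0; exact hx (by simp [h0])), by simp⟩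
  have hφΩ : ∀ i, tsupport (fun x => ⟪b i, η x⟫) ⊆ Ω := by
    intro i
    have hs : support (fun x => ⟪b i, η x⟫) ⊆ tsupport η := fun x hx => by
      by_contra h0
      exact hx (by simp [image_eq_zero_of_notMem_tsupport h0])
    exact (closure_minimal hs (isClosed_tsupport η)).trans hηΩ
  have hterm : ∀ i k v w, Integrable (fun x => ⟪b i, η x⟫ * (⟪V x, b k⟫ * ⟪v, G x w⟫)) volume := fun i k v w =>
    LambIdentity.integrable_mul_mul_of_memLp (hcomp (b k)) (hGcomp v w) (hφ i).contDiff.continuous (hφ i).hasCompactSupport (hφΩ i)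
  -- `M = ⟪V, G η⟫` and `N = ⟪η, G V⟫` are integrable (double sums of such products)
  have hIM : Integrable (fun x => ⟪V x, G x (η x)⟫) volume := by
    have hsum := integrable_finsetSum (Finset.univ : Finset (Fin 3)) fun i _ =>
      integrable_finsetSum (Finset.univ : Finset (Fin 3)) fun k _ => hterm i k (b k) (b i)
    refine hsum.congr (Eventually.of_forall fun x => ?_)
    show ∑ i, ∑ k, ⟪b i, η x⟫ * (⟪V x, b k⟫ * ⟪b k, G x (b i)⟫) = ⟪V x, G x (η x)⟫
    conv_rhs => rw [← b.sum_repr' (η x)]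
    rw [map_sum, inner_sum]
    refine Finset.sum_congr rfl fun i _ => ?_
    rw [map_smul, inner_smul_right, ← b.sum_inner_mul_inner (V x) (G x (b i)), Finset.mul_sum]
  have hIN : Integrable (fun x => ⟪η x, G x (V x)⟫) volume := by
    have hsum := integrable_finsetSum (Finset.univ : Finset (Fin 3)) fun i _ =>
      integrable_finsetSum (Finset.univ : Finset (Fin 3)) fun k _ => hterm i k (b i) (b k)
    refine hsum.congr (Eventually.of_forall fun x => ?_)
    show ∑ i, ∑ k, ⟪b i, η x⟫ * (⟪V x, b k⟫ * ⟪b i, G x (b k)⟫) = ⟪η x, G x (V x)⟫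
    have hu : ∑ k, ⟪V x, b k⟫ • b k = V x := by
      conv_rhs => rw [← b.sum_repr' (V x)]
      exact Finset.sum_congr rfl fun k _ => by rw [real_inner_comm]
    conv_rhs => rw [← hu]
    rw [map_sum, inner_sum, Finset.sum_comm]
    refine Finset.sum_congr rfl fun k _ => ?_
    rw [map_smul, inner_smul_right, ← b.sum_inner_mul_inner (η x) (G x (b k)), Finset.mul_sum]
    refine Finset.sum_congr rfl fun i _ => ?_
    rw [real_inner_comm (b i) (η x)]
    ring
  -- the identity, with `tr G = 0` a.e.
  have e1 : (fun x => ⟪η x, G x (V x)⟫ + ⟪V x, η x⟫ * ∑ j, ⟪b j, G x (b j)⟫) =ᵐ[volume]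
      fun x => (⟪G x (V x), η x⟫ - ⟪G x (η x), V x⟫) + ⟪V x, G x (η x)⟫ := by
    filter_upwards [htr] with x hx
    rw [hx, mul_zero, add_zero, real_inner_comm (G x (V x)) (η x), real_inner_comm (G x (η x)) (V x)]
    ring
  have hIL : Integrable (fun x => ⟪G x (V x), η x⟫ - ⟪G x (η x), V x⟫) volume := by
    refine (hIN.sub hIM).congr (Eventually.of_forall fun x => ?_)
    simp only [Pi.sub_apply]
    rw [real_inner_comm (G x (V x)) (η x), real_inner_comm (G x (η x)) (V x)]
  rw [integral_congr_ae e1, integral_add hIL hIM, LambIdentity.integral_inner_apply_test_eq hG hV2 hG2 hη]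
  have h0 : ∀ x, VectorCalculus.divergence η x = 0 := hdivη
  have hdiv0 : ∫ x, VectorCalculus.divergence η x * ‖V x‖ ^ 2 = 0 := by simp [h0]
  rw [hdiv0, mul_zero, add_zero]

end LambSlice

/-! ## Member level -/

/-- **FROZEN LAMB PAIRINGS IN THE FAR PAST ⇒ TRIVIAL** (member level, every `ρ > 0`, no regularity beyond the class, no ansatz).  Crux hypotheses verbatim,
`T₁ ≤ 0`, and a TIME-INDEPENDENT table `F` with `∫ (⟪H(t,x) u(t,x), η(x)⟫ − ⟪H(t,x) η(x), u(t,x)⟫) dx = F g a b` for a.e. `t < T₁` and every curl pair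
`η = (∂ₐg)b − (∂_b g)a` — the Lamb vector `ω × u` is, modulo gradients, a time-independent distribution.  Then `u = 0` a.e. on the slab: by the slice
identity the velocity-tested advection `∫⟪u, Dη[u]⟫(t) = −F g a b` is a.e. constant in time, so `∫∫ θ'(t)⟪u, Dη[u]⟫ = −F·∫θ' = 0` and
`Loc.ae_eq_zero_of_frozenLambCurlPast` applies. [folklore; MajdaBertozziCUP2002 §2.4] -/
theorem Loc.ae_eq_zero_of_aeFrozenLambPairingPast {ρ : ℝ} (hρ : 0 < ρ)
    {u : ℝ → EuclideanSpace ℝ (Fin 3) → EuclideanSpace ℝ (Fin 3)} {p : ℝ → EuclideanSpace ℝ (Fin 3) → ℝ}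
    {H : ℝ → EuclideanSpace ℝ (Fin 3) → EuclideanSpace ℝ (Fin 3) →L[ℝ] EuclideanSpace ℝ (Fin 3)} {c : ℝ≥0}
    (hsw : IsSuitableWeakSolutionOn (slab (EuclideanSpace ℝ (Fin 3)) (Iio 0) isOpen_Iio) 0 0 u p)
    (hH : HasWeakSpatialGradientOn (slab (EuclideanSpace ℝ (Fin 3)) (Iio 0) isOpen_Iio) u H)
    (hgauge : ∀ a : ℝ, 0 < a →
      ENNReal.ofReal (a ^ (2 * ρ)) * cknA a (0 : ℝ × EuclideanSpace ℝ (Fin 3)) u +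
          ENNReal.ofReal (a ^ ρ) * cknE a (0 : ℝ × EuclideanSpace ℝ (Fin 3)) H +
        ENNReal.ofReal (a ^ (2 * ρ)) * cknD a (0 : ℝ × EuclideanSpace ℝ (Fin 3)) p ≤ (c : ℝ≥0∞))
    {T₁ : ℝ} (hT₁ : T₁ ≤ 0) (F : (EuclideanSpace ℝ (Fin 3) → ℝ) → EuclideanSpace ℝ (Fin 3) → EuclideanSpace ℝ (Fin 3) → ℝ)
    (hLamb : ∀ᵐ t ∂(volume.restrict (Iio T₁)),
      ∀ g : EuclideanSpace ℝ (Fin 3) → ℝ, IsTestFunctionOn (⊤ : Opens (EuclideanSpace ℝ (Fin 3))) g → ∀ a b : EuclideanSpace ℝ (Fin 3),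
        ∫ x, (⟪H t x (u t x), fderiv ℝ g x a • b - fderiv ℝ g x b • a⟫ - ⟪H t x (fderiv ℝ g x a • b - fderiv ℝ g x b • a), u t x⟫) = F g a b) :
    uncurry u =ᵐ[volume.restrict (Iio (0 : ℝ) ×ˢ (univ : Set (EuclideanSpace ℝ (Fin 3))))] 0 := by
  have hdist := hsw.distributional
  have hprod : ∀ S : Set ℝ, (volume.restrict (S ×ˢ (univ : Set (EuclideanSpace ℝ (Fin 3)))) : Measure (ℝ × EuclideanSpace ℝ (Fin 3))) =
      ((volume : Measure ℝ).restrict S).prod (volume : Measure (EuclideanSpace ℝ (Fin 3))) := by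
    intro S
    rw [Measure.volume_eq_prod, ← Measure.restrict_univ (μ := (volume : Measure (EuclideanSpace ℝ (Fin 3)))),
      Measure.prod_restrict, Measure.restrict_univ]
  -- adapted from Theorems/EulerZoomLiouvillePowerGaugeEulerLiouvilleBeltramiPastMember.lean (hand g3): good slices
  -- (1) a.e. slice has the weak gradient `H t`
  have h1 : ∀ᵐ t ∂(volume.restrict (Iio T₁)),
      HasWeakFDerivOn (⊤ : Opens (EuclideanSpace ℝ (Fin 3))) volume (u t) (H t) := FrameSteady.ae_hasWeakFDerivOn_slice_past hH hT₁
  -- (2) `|u(t)|² ∈ L¹_loc` for a.e. slice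
  have h2 : ∀ᵐ t ∂(volume.restrict (Iio T₁)), LocallyIntegrable (fun x => ‖u t x‖ ^ 2) volume := by
    have hu2 : LocallyIntegrableOn (fun z => ‖uncurry u z‖ ^ 2)
        ((slab (EuclideanSpace ℝ (Fin 3)) (Iio 0) isOpen_Iio : Opens (ℝ × EuclideanSpace ℝ (Fin 3))) : Set (ℝ × EuclideanSpace ℝ (Fin 3))) volume :=
      hdist.2.1
    have h := ae_slice_locallyIntegrable (g := fun z : ℝ × EuclideanSpace ℝ (Fin 3) => ‖uncurry u z‖ ^ 2)
      (fun K hK hKQ => hu2.integrableOn_compact_subset hKQ hK)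
    rw [ae_restrict_iff' measurableSet_Iio]
    filter_upwards [h] with t ht htT
    exact ht (lt_of_lt_of_le htT hT₁)
  -- (3) `|H(t)|² ∈ L¹_loc` for a.e. slice
  have h3 : ∀ᵐ t ∂(volume.restrict (Iio T₁)), LocallyIntegrable (fun x => ‖H t x‖ ^ 2) volume := by
    obtain ⟨G, hG, hG2, -⟩ := hsw.localEnergy
    have hae := hH.ae_eq hG
    have hHm : AEStronglyMeasurable (uncurry H)
        (volume.restrict ((slab (EuclideanSpace ℝ (Fin 3)) (Iio 0) isOpen_Iio : Opens (ℝ × EuclideanSpace ℝ (Fin 3))) :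
          Set (ℝ × EuclideanSpace ℝ (Fin 3)))) := hH.locallyIntegrableOn_grad.aestronglyMeasurable
    have hK : ∀ K : Set (ℝ × EuclideanSpace ℝ (Fin 3)), IsCompact K →
        K ⊆ ((slab (EuclideanSpace ℝ (Fin 3)) (Iio 0) isOpen_Iio : Opens (ℝ × EuclideanSpace ℝ (Fin 3))) : Set (ℝ × EuclideanSpace ℝ (Fin 3))) →
        IntegrableOn (fun z : ℝ × EuclideanSpace ℝ (Fin 3) => ‖uncurry H z‖ ^ 2) K volume := by
      intro K hKc hKQ
      have hm : AEStronglyMeasurable (fun z : ℝ × EuclideanSpace ℝ (Fin 3) => ‖uncurry H z‖ ^ 2) (volume.restrict K) :=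
        ((hHm.mono_set hKQ).norm.pow 2)
      refine ⟨hm, ?_⟩
      have hfin := hG2 K hKQ hKc
      have haeK : ∀ᵐ z ∂(volume.restrict K), uncurry H z = uncurry G z := ae_restrict_of_ae_restrict_of_subset hKQ hae
      refine lt_of_le_of_lt ?_ hfin
      refine lintegral_mono_ae ?_
      filter_upwards [haeK] with z hz
      rw [← ofReal_norm, norm_pow, norm_norm]
      refine ENNReal.ofReal_le_ofReal ?_
      have := norm_sq_le_frobeniusNormSq (G z.1 z.2)
      have e : uncurry H z = G z.1 z.2 := hz
      rw [e]
      exact this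
    have h := ae_slice_locallyIntegrable (g := fun z : ℝ × EuclideanSpace ℝ (Fin 3) => ‖uncurry H z‖ ^ 2) hK
    rw [ae_restrict_iff' measurableSet_Iio]
    filter_upwards [h] with t ht htT
    exact ht (lt_of_lt_of_le htT hT₁)
  -- (4) trace-free slices
  have h4 : ∀ᵐ t ∂(volume.restrict (Iio T₁)), ∀ᵐ x ∂(volume : Measure (EuclideanSpace ℝ (Fin 3))),
      ∑ j, ⟪(EuclideanSpace.basisFun (Fin 3) ℝ) j, H t x ((EuclideanSpace.basisFun (Fin 3) ℝ) j)⟫ = 0 := by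
    have htr := SerrinBoundedHolder.ae_trace_eq_zero hdist hH
    have h' : ∀ᵐ z ∂(volume.restrict (Iio T₁ ×ˢ (univ : Set (EuclideanSpace ℝ (Fin 3))))),
        ∑ j, H z.1 z.2 (EuclideanSpace.single j (1 : ℝ)) j = 0 := by
      rw [ae_restrict_iff' (measurableSet_Iio.prod MeasurableSet.univ)]
      filter_upwards [htr] with z hz hmem
      exact hz (by
        have : z.1 < 0 := lt_of_lt_of_le (mem_prod.1 hmem).1 hT₁
        simpa [slab] using this)
    rw [hprod] at h'
    filter_upwards [Measure.ae_ae_of_ae_prod h'] with t ht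
    filter_upwards [ht] with x hx
    rw [← hx]
    refine Finset.sum_congr rfl fun j _ => ?_
    rw [EuclideanSpace.basisFun_apply, EuclideanSpace.inner_single_left]
    simp
  -- the velocity-tested advection of a.e. slice is the constant `−F g a b`
  have hslice : ∀ᵐ t ∂(volume.restrict (Iio T₁)),
      ∀ g : EuclideanSpace ℝ (Fin 3) → ℝ, IsTestFunctionOn (⊤ : Opens (EuclideanSpace ℝ (Fin 3))) g → ∀ a b : EuclideanSpace ℝ (Fin 3),
        ∫ x, ⟪u t x, fderiv ℝ (fun x => fderiv ℝ g x a • b - fderiv ℝ g x b • a) x (u t x)⟫ = -F g a b := by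
    filter_upwards [h1, h2, h3, h4, hLamb] with t ht1 ht2 ht3 ht4 ht5
    intro g hg a b
    rw [LambSlice.integral_inner_fderiv_apply_self_eq_neg_lambPairing ht1 ht2 ht3 ht4 hg a b, ht5 g hg a b]
  -- assemble: `∫∫ θ'(t)⟪u, Dη[u]⟫ = ∫ θ'(t) (−F) dt = 0`
  refine Loc.ae_eq_zero_of_frozenLambCurlPast hρ hsw hH hgauge hT₁ fun θ hθ hθc hθT g hg a b => ?_
  set η : EuclideanSpace ℝ (Fin 3) → EuclideanSpace ℝ (Fin 3) := fun x => fderiv ℝ g x a • b - fderiv ℝ g x b • a with hηdef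
  have hη := isTestFunctionOn_curlPair hg a b
  have hθT0 : tsupport θ ⊆ Iio 0 := hθT.trans (Iio_subset_Iio hT₁)
  have hu : LocallyIntegrableOn (uncurry u) (Iio 0 ×ˢ (univ : Set (EuclideanSpace ℝ (Fin 3)))) volume := by
    simpa only [coe_slab] using hdist.1
  have hum : AEStronglyMeasurable (uncurry u) (volume.restrict (Iio (0 : ℝ) ×ˢ (univ : Set (EuclideanSpace ℝ (Fin 3))))) :=
    hu.aestronglyMeasurable
  have hu2 : LocallyIntegrableOn (fun z => ‖uncurry u z‖ ^ 2) (Iio (0 : ℝ) ×ˢ (univ : Set (EuclideanSpace ℝ (Fin 3)))) volume := by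
    simpa only [coe_slab] using hdist.2.1
  obtain ⟨hκ, hκc, hκT⟩ := AntiMember.deriv_cutoff_props hθ hθc hθT0
  have iB := AntiMember.integrable_mul_inner_fderiv_apply hum hu2 hκ hκc hκT (hη.contDiff.of_le (by norm_cast)) hη.hasCompactSupport
  rw [Measure.volume_eq_prod] at iB
  rw [Measure.volume_eq_prod, integral_prod _ iB]
  have hpt : ∀ᵐ t ∂(volume : Measure ℝ),
      ∫ x, deriv θ t * ⟪u t x, fderiv ℝ η x (u t x)⟫ = deriv θ t * (-F g a b) := by
    filter_upwards [ae_imp_of_ae_restrict hslice] with t ht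
    by_cases htT : t < T₁
    · rw [integral_const_mul, ht htT g hg a b]
    · rw [AntiMember.deriv_eq_zero_of_tsupport_subset_Iio hθT (not_lt.1 htT)]
      simp
  show ∫ t, ∫ x, deriv θ t * ⟪u t x, fderiv ℝ η x (u t x)⟫ = 0
  rw [integral_congr_ae hpt, integral_mul_const,
    Elgindi.integral_deriv_eq_zero_of_hasCompactSupport (hθ.of_le (by norm_cast)) hθc, zero_mul]

/-- **FROZEN LAMB VECTOR IN THE FAR PAST ⇒ TRIVIAL** (member level, every `ρ > 0`): crux hypotheses verbatim, `T₁ ≤ 0`, and a time-independent field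
`L : ℝ³ → ℝ³` (no regularity, measurability or decay assumed) with `⟪H(t,x) u(t,x), w⟫ − ⟪H(t,x) w, u(t,x)⟫ = ⟪L(x), w⟫` for a.e. `(t,x) ∈ (−∞,T₁) × ℝ³` and all
`w` — the Lamb vector `ω × u = (H − Hᵀ)u` does not depend on time.  Then `u = 0` a.e. on the slab.  `L = 0` is hand g3's `Loc.ae_eq_zero_of_aeBeltramiPast`.
[folklore; MajdaBertozziCUP2002 §2.4] -/
theorem Loc.ae_eq_zero_of_aeFrozenLambVectorPast {ρ : ℝ} (hρ : 0 < ρ)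
    {u : ℝ → EuclideanSpace ℝ (Fin 3) → EuclideanSpace ℝ (Fin 3)} {p : ℝ → EuclideanSpace ℝ (Fin 3) → ℝ}
    {H : ℝ → EuclideanSpace ℝ (Fin 3) → EuclideanSpace ℝ (Fin 3) →L[ℝ] EuclideanSpace ℝ (Fin 3)} {c : ℝ≥0}
    (hsw : IsSuitableWeakSolutionOn (slab (EuclideanSpace ℝ (Fin 3)) (Iio 0) isOpen_Iio) 0 0 u p)
    (hH : HasWeakSpatialGradientOn (slab (EuclideanSpace ℝ (Fin 3)) (Iio 0) isOpen_Iio) u H)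
    (hgauge : ∀ a : ℝ, 0 < a →
      ENNReal.ofReal (a ^ (2 * ρ)) * cknA a (0 : ℝ × EuclideanSpace ℝ (Fin 3)) u +
          ENNReal.ofReal (a ^ ρ) * cknE a (0 : ℝ × EuclideanSpace ℝ (Fin 3)) H +
        ENNReal.ofReal (a ^ (2 * ρ)) * cknD a (0 : ℝ × EuclideanSpace ℝ (Fin 3)) p ≤ (c : ℝ≥0∞))
    {T₁ : ℝ} (hT₁ : T₁ ≤ 0) {L : EuclideanSpace ℝ (Fin 3) → EuclideanSpace ℝ (Fin 3)}
    (hLamb : ∀ᵐ z ∂(volume.restrict (Iio T₁ ×ˢ (univ : Set (EuclideanSpace ℝ (Fin 3))))),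
      ∀ w : EuclideanSpace ℝ (Fin 3), ⟪H z.1 z.2 (u z.1 z.2), w⟫ - ⟪H z.1 z.2 w, u z.1 z.2⟫ = ⟪L z.2, w⟫) :
    uncurry u =ᵐ[volume.restrict (Iio (0 : ℝ) ×ˢ (univ : Set (EuclideanSpace ℝ (Fin 3))))] 0 := by
  refine Loc.ae_eq_zero_of_aeFrozenLambPairingPast hρ hsw hH hgauge hT₁
    (fun g a b => ∫ x, ⟪L x, fderiv ℝ g x a • b - fderiv ℝ g x b • a⟫) ?_
  have e : (volume.restrict (Iio T₁ ×ˢ (univ : Set (EuclideanSpace ℝ (Fin 3)))) : Measure (ℝ × EuclideanSpace ℝ (Fin 3))) =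
      ((volume : Measure ℝ).restrict (Iio T₁)).prod (volume : Measure (EuclideanSpace ℝ (Fin 3))) := by
    rw [Measure.volume_eq_prod, ← Measure.restrict_univ (μ := (volume : Measure (EuclideanSpace ℝ (Fin 3)))),
      Measure.prod_restrict, Measure.restrict_univ]
  rw [e] at hLamb
  filter_upwards [Measure.ae_ae_of_ae_prod hLamb] with t ht
  intro g _ a b
  refine integral_congr_ae ?_
  filter_upwards [ht] with x hx
  exact hx _

/-! ## Binder language -/

/-- **Binder language: NO MEMBER HAS TIME-INDEPENDENT LAMB PAIRINGS IN ITS FAR PAST**: for some `T₁ ≤ 0` and some time-independent table `F`, for a.e. `t < T₁`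
the Lamb vector of the slice pairs with every curl pair `η` as `∫ (⟪H u, η⟫ − ⟪H η, u⟫) = F g a b` ⇒ the member is trivial (`F = 0`:
`Birth.nonSelfSimilar_of_aeLambGradientPast`). [folklore] -/
theorem Birth.nonSelfSimilar_of_aeFrozenLambPairingPast :
    ∀ ρ : ℝ, 0 < ρ →
      ∀ (u : ℝ → EuclideanSpace ℝ (Fin 3) → EuclideanSpace ℝ (Fin 3)) (p : ℝ → EuclideanSpace ℝ (Fin 3) → ℝ)
        (H : ℝ → EuclideanSpace ℝ (Fin 3) → EuclideanSpace ℝ (Fin 3) →L[ℝ] EuclideanSpace ℝ (Fin 3)) (c : ℝ≥0),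
        Birth.InClass ρ u p H c →
          (∃ T₁ : ℝ, T₁ ≤ 0 ∧ ∃ F : (EuclideanSpace ℝ (Fin 3) → ℝ) → EuclideanSpace ℝ (Fin 3) → EuclideanSpace ℝ (Fin 3) → ℝ,
            ∀ᵐ t ∂(volume.restrict (Iio T₁)),
              ∀ g : EuclideanSpace ℝ (Fin 3) → ℝ, IsTestFunctionOn (⊤ : Opens (EuclideanSpace ℝ (Fin 3))) g → ∀ a b : EuclideanSpace ℝ (Fin 3),
                ∫ x, (⟪H t x (u t x), fderiv ℝ g x a • b - fderiv ℝ g x b • a⟫ -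
                  ⟪H t x (fderiv ℝ g x a • b - fderiv ℝ g x b • a), u t x⟫) = F g a b) →
          uncurry u =ᵐ[volume.restrict (Iio (0 : ℝ) ×ˢ (univ : Set (EuclideanSpace ℝ (Fin 3))))] 0 := by
  intro ρ hρ u p H c hcl h
  obtain ⟨T₁, hT₁, F, hF⟩ := h
  exact Loc.ae_eq_zero_of_aeFrozenLambPairingPast hρ hcl.1 hcl.2.1 hcl.2.2 hT₁ F hF

/-- **Binder language: NO MEMBER HAS A TIME-INDEPENDENT LAMB VECTOR IN ITS FAR PAST**: `⟪H(t,x)u(t,x), w⟫ − ⟪H(t,x)w, u(t,x)⟫ = ⟪L(x), w⟫` for a.e.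
`(t,x) ∈ (−∞,T₁) × ℝ³`, all `w`, some `T₁ ≤ 0` and some `L : ℝ³ → ℝ³` — `ω × u = L(x)` — ⇒ the member is trivial (`L = 0`: `Birth.nonSelfSimilar_of_aeBeltramiPast`).
[folklore] -/
theorem Birth.nonSelfSimilar_of_aeFrozenLambVectorPast :
    ∀ ρ : ℝ, 0 < ρ →
      ∀ (u : ℝ → EuclideanSpace ℝ (Fin 3) → EuclideanSpace ℝ (Fin 3)) (p : ℝ → EuclideanSpace ℝ (Fin 3) → ℝ)
        (H : ℝ → EuclideanSpace ℝ (Fin 3) → EuclideanSpace ℝ (Fin 3) →L[ℝ] EuclideanSpace ℝ (Fin 3)) (c : ℝ≥0),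
        Birth.InClass ρ u p H c →
          (∃ T₁ : ℝ, T₁ ≤ 0 ∧ ∃ L : EuclideanSpace ℝ (Fin 3) → EuclideanSpace ℝ (Fin 3),
            ∀ᵐ z ∂(volume.restrict (Iio T₁ ×ˢ (univ : Set (EuclideanSpace ℝ (Fin 3))))),
              ∀ w : EuclideanSpace ℝ (Fin 3), ⟪H z.1 z.2 (u z.1 z.2), w⟫ - ⟪H z.1 z.2 w, u z.1 z.2⟫ = ⟪L z.2, w⟫) →
          uncurry u =ᵐ[volume.restrict (Iio (0 : ℝ) ×ˢ (univ : Set (EuclideanSpace ℝ (Fin 3))))] 0 := by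
  intro ρ hρ u p H c hcl h
  obtain ⟨T₁, hT₁, L, hL⟩ := h
  exact Loc.ae_eq_zero_of_aeFrozenLambVectorPast hρ hcl.1 hcl.2.1 hcl.2.2 hT₁ hL

end Summit.NavierStokesRegularity.NavierStokesRegularity.Theorems.PowerGaugeEulerLiouville

end
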